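import Summits.AtomisticToContinuum.HydrodynamicLimit.Theses.TwoClocks
import Summits.AtomisticToContinuum.HydrodynamicLimit.Theses.ImplosionDichotomy
import Summits.AtomisticToContinuum.HydrodynamicLimit.Theorems.DenseExcursion.Negative.Dichotomy
import Summits.AtomisticToContinuum.HydrodynamicLimit.Theorems.DiluteSelfConsistency.Negative.Quantifiers
import Summits.AtomisticToContinuum.HydrodynamicLimit.Theorems.DiluteSelfConsistency.Negative.ProfileUniform
import Literature.Analysis.FunctionSpaces.TorusSpaceTime

/-!
# `DiluteSelfConsistency` (stmt-AtomisticToContinuum-3091) — crux-strategist (wall-breaker) companion sketch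

Seat planner-cstrat-stmt-AtomisticToContinuum-3091-p1-0, 2026-08-17. Companion of `STRATEGY-CENSUS.md`.
Kernel-checked content of the census's `## Decomposition` and `## Strengthen` attempts — NOT a skeleton line
(no `stub_*`, nothing here concludes the crux from open stubs; see the census for why no line is registered).

* §1 `DSCAt` / `dsc_iff` — the crux level-by-level, profile-by-profile (bookkeeping).
* §2 DECOMPOSITION ATTEMPT A (by the fate of the IDEAL development): classifier `IdealCompressionBounded`,
  sub-cruxes `DiluteOnBoundedIdealCompression` (Case I) / `DiluteOnUnboundedIdealCompression` (Case II) and the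
  glue `diluteSelfConsistency_of_cases` (pure logic). Case II is where the crux is decided (expected FALSE: it
  contains every `DenseExcursion` witness profile) — so the split relocates the crux, it does not cut it.
* §3 DECOMPOSITION ATTEMPT B (by TIME): `PreSingularDiluteness` (dilute on `[0, T₂]` for every `T₂` short of an
  ideal classical lifespan) is PROVED from the route support `EosContinuity` (stmt-12589, open, L):
  `preSingularDiluteness_of_eosContinuity`. The complementary piece (the window `[T₂, T*_σ)` at the ideal first
  singularity, σ₀ allowed to depend on `T₂`) is the whole crux again: `σ₀(η, p, T₂)` has no positive limit as
  `T₂ ↑ T*₀(p)` at a tuned implosion profile.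
* §4 STRENGTHEN: every rigid strengthening on record is refuted in the tree (re-exported by name).
-/

noncomputable section

namespace Summit.AtomisticToContinuum.HydrodynamicLimit.Cruxes.DiluteSelfConsistency.Strategist

open MeasureTheory Filter Set Topology
open Literature.MathematicalPhysics.KineticTheory Literature.Analysis.FluidPDE Literature.Analysis.FunctionSpaces
open Summit.AtomisticToContinuum.HydrodynamicLimit.Theses
open Summit.AtomisticToContinuum.HydrodynamicLimit.Theorems
open Summit.AtomisticToContinuum.HydrodynamicLimit.Theorems.DenseExcursionDichotomy

/-! ## §1 The crux at one level and one profile -/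

/-- The inner clause of the crux at level `η` for the profiles `(a₀, θ₀, u₀)` (with its `∃ σ₀`). -/
def DSCAt (η : ℝ) (a₀ θ₀ : T3 → ℝ) (u₀ : T3 → V3) : Prop :=
  ∃ σ₀ : ℝ, 0 < σ₀ ∧ ∀ σ : ℝ, 0 < σ → σ < σ₀ →
    ∀ (T : ℝ) (ρ θ : ℝ → T3 → ℝ) (u : ℝ → T3 → V3), IsHardSphereEulerSolution σ T ρ u θ →
      ∀ Φ : (N : ℕ) → HardSphereFlow (Torus.geometry (Fin 3)) (hsDiameter σ N) (N + 1),
        TendstoHydroFieldsAt (fun N => localGibbsLaw σ a₀ u₀ θ₀ N (Φ N)) Φ ρ u θ 0 →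
          ∀ t ∈ Ico 0 T, ∀ x, ρ t x * σ ^ 3 < η

/-- The payload route's copy of the crux is the canonical one (ImplosionDichotomy) — one term. -/
theorem twoClocks_dsc_iff : TwoClocks.DiluteSelfConsistency ↔ ImplosionDichotomy.DiluteSelfConsistency := Iff.rfl

/-- The crux is `∀ η > 0, ∀ continuous positive profiles, DSCAt η a₀ θ₀ u₀` (definitional). -/
theorem dsc_iff : TwoClocks.DiluteSelfConsistency ↔
    ∀ η : ℝ, 0 < η → ∀ (a₀ θ₀ : T3 → ℝ) (u₀ : T3 → V3), Continuous a₀ → Continuous θ₀ → Continuous u₀ →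
      (∀ x, 0 < a₀ x) → (∀ x, 0 < θ₀ x) → DSCAt η a₀ θ₀ u₀ := Iff.rfl

/-- The crux is the negation of the sibling crux `DenseExcursion` (landed dichotomy; restated for the TwoClocks copy). -/
theorem dsc_iff_not_denseExcursion : TwoClocks.DiluteSelfConsistency ↔ ¬ ImplosionDichotomy.DenseExcursion :=
  not_denseExcursion_iff_diluteSelfConsistency.symm

/-! ## §2 Decomposition attempt A — by the fate of the ideal (`σ = 0`) development -/

/-- CLASSIFIER. The ideal-gas (`σ = 0`, `p = ρθ`) classical developments of the pinned reference data
`(a₀/∫a₀, u₀, θ₀)` have density bounded by one constant `M` on their whole interval of classical existence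
(all of them: by uniqueness they are restrictions of the maximal one). Case I of the census. -/
def IdealCompressionBounded (a₀ θ₀ : T3 → ℝ) (u₀ : T3 → V3) : Prop :=
  ∃ M : ℝ, ∀ (T₁ : ℝ) (ρ₁ θ₁ : ℝ → T3 → ℝ) (u₁ : ℝ → T3 → V3), IsHardSphereEulerSolution 0 T₁ ρ₁ u₁ θ₁ →
    (∀ x, ρ₁ 0 x = a₀ x / ∫ y, a₀ y) → u₁ 0 = u₀ → θ₁ 0 = θ₀ → ∀ t ∈ Ico 0 T₁, ∀ x, ρ₁ t x ≤ M

/-- SUB-CRUX I ("bounded ideal compression ⇒ dilute"): σ-stability of BOUNDED-density first singularities (and of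
bounded global developments) under the `O(σ³)` equation-of-state-and-data perturbation, for EVERY such profile.
Believed true; classification-strength (LukSpeck2024 / Sideris1985 cover open sets of data only). -/
def DiluteOnBoundedIdealCompression : Prop :=
  ∀ η : ℝ, 0 < η → ∀ (a₀ θ₀ : T3 → ℝ) (u₀ : T3 → V3), Continuous a₀ → Continuous θ₀ → Continuous u₀ →
    (∀ x, 0 < a₀ x) → (∀ x, 0 < θ₀ x) → IdealCompressionBounded a₀ θ₀ u₀ → DSCAt η a₀ θ₀ u₀

/-- SUB-CRUX II ("unbounded ideal compression ⇒ still dilute at `σ > 0`"): ejection from EVERY smooth implosion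
channel for every profile whose ideal development has unbounded density. Expected FALSE — it contains every
`DenseExcursion` witness profile (tuned threshold data of `SS(r₂)`); this leaf IS the crux in substance. -/
def DiluteOnUnboundedIdealCompression : Prop :=
  ∀ η : ℝ, 0 < η → ∀ (a₀ θ₀ : T3 → ℝ) (u₀ : T3 → V3), Continuous a₀ → Continuous θ₀ → Continuous u₀ →
    (∀ x, 0 < a₀ x) → (∀ x, 0 < θ₀ x) → ¬ IdealCompressionBounded a₀ θ₀ u₀ → DSCAt η a₀ θ₀ u₀

/-- GLUE of attempt A (pure logic: case split on the classifier). Typed, proved, and NOT filed as a `--split`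
(census §Decomposition: leaf II relocates the whole decision; leaf I is decision-irrelevant). -/
theorem diluteSelfConsistency_of_cases (hI : DiluteOnBoundedIdealCompression)
    (hII : DiluteOnUnboundedIdealCompression) : TwoClocks.DiluteSelfConsistency := by
  intro η hη a₀ θ₀ u₀ ha hθ hu ha0 hθ0
  by_cases hb : IdealCompressionBounded a₀ θ₀ u₀
  · exact hI η hη a₀ θ₀ u₀ ha hθ hu ha0 hθ0 hb
  · exact hII η hη a₀ θ₀ u₀ ha hθ hu ha0 hθ0 hb

/-- …and conversely both leaves follow from the crux (they are restrictions of it): the split is EXACT. -/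
theorem cases_of_diluteSelfConsistency (h : TwoClocks.DiluteSelfConsistency) :
    DiluteOnBoundedIdealCompression ∧ DiluteOnUnboundedIdealCompression :=
  ⟨fun η hη a₀ θ₀ u₀ ha hθ hu ha0 hθ0 _ => h η hη a₀ θ₀ u₀ ha hθ hu ha0 hθ0,
   fun η hη a₀ θ₀ u₀ ha hθ hu ha0 hθ0 _ => h η hη a₀ θ₀ u₀ ha hθ hu ha0 hθ0⟩

/-! ## §3 Decomposition attempt B — by time: diluteness strictly before an ideal classical lifespan -/

/-- PRE-SINGULAR DILUTENESS: for every ideal classical development `(ρ₁,u₁,θ₁)` on `[0,T₁)` of the reference data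
and every `T₂ < T₁` there is `σ₀ = σ₀(η, profiles, T₂)` below which every admissible hard-sphere-Euler solution is
dilute on `[0, T₂]`. TRUE (proved next from `EosContinuity`); its `σ₀` degenerates as `T₂ ↑ T₁`. -/
def PreSingularDiluteness : Prop :=
  ∀ η : ℝ, 0 < η → ∀ (a₀ θ₀ : T3 → ℝ) (u₀ : T3 → V3), Continuous a₀ → Continuous θ₀ → Continuous u₀ →
    (∀ x, 0 < a₀ x) → (∀ x, 0 < θ₀ x) →
    ∀ (T₁ : ℝ) (ρ₁ θ₁ : ℝ → T3 → ℝ) (u₁ : ℝ → T3 → V3), IsHardSphereEulerSolution 0 T₁ ρ₁ u₁ θ₁ →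
      (∀ x, ρ₁ 0 x = a₀ x / ∫ y, a₀ y) → u₁ 0 = u₀ → θ₁ 0 = θ₀ → ∀ T₂ : ℝ, 0 < T₂ → T₂ < T₁ →
      ∃ σ₀ : ℝ, 0 < σ₀ ∧ ∀ σ : ℝ, 0 < σ → σ < σ₀ →
        ∀ (T : ℝ) (ρ θ : ℝ → T3 → ℝ) (u : ℝ → T3 → V3), IsHardSphereEulerSolution σ T ρ u θ →
          ∀ Φ : (N : ℕ) → HardSphereFlow (Torus.geometry (Fin 3)) (hsDiameter σ N) (N + 1),
            TendstoHydroFieldsAt (fun N => localGibbsLaw σ a₀ u₀ θ₀ N (Φ N)) Φ ρ u θ 0 →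
              ∀ t ∈ Ico 0 T, t ≤ T₂ → ∀ x, ρ t x * σ ^ 3 < η

/-- **`EosContinuity → PreSingularDiluteness`** (the census's only provable positive rung beyond `Mirror.lean`):
the ideal density is bounded by some `C` on the compact slab `[0,T₂] × 𝕋³` (joint smoothness), `EosContinuity`
with `ε = 1` puts every admissible σ-solution within `1` of it there, and `(C+1)σ³ < η` once `σ < min(1, η/(C+1))`.
The `t = 0` tie through ONE flow family is the tie through all (`tendstoHydroFieldsAt_zero_transfer`). -/
theorem preSingularDiluteness_of_eosContinuity (hE : ImplosionDichotomy.EosContinuity) : PreSingularDiluteness := by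
  intro η hη a₀ θ₀ u₀ ha hθ hu ha0 hθ0 T₁ ρ₁ θ₁ u₁ hsol h0 hu0 hθ₀ T₂ hT₂ hT₂1
  -- sup bound of the ideal density on the compact slab `[0, T₂] × 𝕋³`
  obtain ⟨C, hC⟩ := hsol.smooth_density.exists_norm_le_of_isCompact isCompact_Icc
    (fun t ht => ⟨ht.1, lt_of_le_of_lt ht.2 hT₂1⟩)
  have hC0 : 0 ≤ C := le_trans (norm_nonneg _) (hC 0 ⟨le_rfl, hT₂.le⟩ 0)
  -- EOS continuity with tolerance 1 on `[0, T₂]`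
  obtain ⟨σ₁, hσ₁, H⟩ := hE a₀ θ₀ u₀ ha hθ hu ha0 hθ0 T₁ ρ₁ θ₁ u₁ hsol h0 hu0 hθ₀ T₂ hT₂ hT₂1 1 one_pos
  refine ⟨min σ₁ (min 1 (η / (C + 1))), lt_min hσ₁ (lt_min one_pos (div_pos hη (by linarith))), ?_⟩
  intro σ hσ hσlt T ρ θ u hsolσ Φ htie t ht htT₂ x
  have hσ₁' : σ < σ₁ := lt_of_lt_of_le hσlt (min_le_left _ _)
  have hσ1 : σ < 1 := lt_of_lt_of_le hσlt ((min_le_right _ _).trans (min_le_left _ _))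
  have hση : σ < η / (C + 1) := lt_of_lt_of_le hσlt ((min_le_right _ _).trans (min_le_right _ _))
  have hclose := (H σ hσ hσ₁').2 T ρ θ u hsolσ (fun Ψ => tendstoHydroFieldsAt_zero_transfer Φ Ψ htie)
    t ht htT₂ x
  have hρ₁ : ρ₁ t x ≤ C := le_trans (Real.le_norm_self _) (hC t ⟨ht.1, htT₂⟩ x)
  have hρ : ρ t x < C + 1 := by
    have := (abs_lt.1 hclose).2
    linarith
  have hσ3 : σ ^ 3 ≤ σ := by
    have h1 : σ ^ 3 ≤ σ ^ 1 := pow_le_pow_of_le_one hσ.le hσ1.le (by norm_num)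
    simpa using h1
  have hC1 : 0 < C + 1 := by linarith
  have hρpos : 0 < ρ t x := hsolσ.density_pos t ht x
  calc ρ t x * σ ^ 3 ≤ ρ t x * σ := mul_le_mul_of_nonneg_left hσ3 hρpos.le
    _ < (C + 1) * (η / (C + 1)) := mul_lt_mul'' hρ hση hρpos.le hσ.le
    _ = η := by field_simp

/-- What attempt B leaves. DSC at a profile needs diluteness on the WHOLE classical life `[0, T*_σ)`; attempt B
delivers `[0, T₂]` for each `T₂` short of an ideal lifespan with a `T₂`-DEPENDENT threshold. The residual piece,
typed: diluteness on the windows `(T₂, T)` with a threshold that may depend on `T₂` — i.e. σ-uniform control AT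
the ideal first singularity. This is the crux again (at a tuned implosion profile the needed `σ₀(T₂) → 0` as
`T₂ ↑ T*₀`), recorded as a definition only. -/
def NearSingularDiluteness : Prop :=
  ∀ η : ℝ, 0 < η → ∀ (a₀ θ₀ : T3 → ℝ) (u₀ : T3 → V3), Continuous a₀ → Continuous θ₀ → Continuous u₀ →
    (∀ x, 0 < a₀ x) → (∀ x, 0 < θ₀ x) → ∃ T₂ : ℝ, 0 < T₂ ∧
      ∃ σ₀ : ℝ, 0 < σ₀ ∧ ∀ σ : ℝ, 0 < σ → σ < σ₀ →
        ∀ (T : ℝ) (ρ θ : ℝ → T3 → ℝ) (u : ℝ → T3 → V3), IsHardSphereEulerSolution σ T ρ u θ →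
          ∀ Φ : (N : ℕ) → HardSphereFlow (Torus.geometry (Fin 3)) (hsDiameter σ N) (N + 1),
            TendstoHydroFieldsAt (fun N => localGibbsLaw σ a₀ u₀ θ₀ N (Φ N)) Φ ρ u θ 0 →
              ∀ t ∈ Ico 0 T, T₂ < t → ∀ x, ρ t x * σ ^ 3 < η

/-! ## §4 Strengthen — every rigid `S⁺` on record is refuted in the tree (re-exported by name) -/

/-- `S⁺₁`: a σ-uniform density bound `ρ ≤ M(profiles)` — REFUTED (`PolynomialCompression` PROVED). -/
theorem strengthen_boundedDensity_false : ¬ DiluteSelfConsistencyBoundedDensity :=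
  not_diluteSelfConsistencyBoundedDensity

/-- `S⁺₂`: a polynomial rate `packing < σ^(3-κ)` — REFUTED (same witness). -/
theorem strengthen_polynomialRate_false : ¬ DiluteSelfConsistencyPolynomialRate :=
  not_diluteSelfConsistencyPolynomialRate

/-- `S⁺₃`: a threshold chosen before the profiles — REFUTED at `t = 0` (tall activity peaks). -/
theorem strengthen_profileUniform_false : ¬ DiluteSelfConsistencyProfileUniform :=
  not_diluteSelfConsistencyProfileUniform

/-- `S⁺₄`: a threshold chosen before the level — REFUTED. -/
theorem strengthen_levelUniform_false : ¬ DiluteSelfConsistencyLevelUniform :=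
  not_diluteSelfConsistencyLevelUniform

end Summit.AtomisticToContinuum.HydrodynamicLimit.Cruxes.DiluteSelfConsistency.Strategist

end
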